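import Mathlib
import HarnessLib
import Literature.Probability.MarkovChains.SeparationDistance
import Literature.Probability.MarkovChains.LazyChainSpectrum
import Literature.Probability.MarkovChains.ErgodicSumVariance

/-!
# Return probabilities of a reversible chain decrease: `P^{2t+2}(x,x) ≤ P^{2t}(x,x)`, and `P^{t+1}(x,x) ≤ P^t(x,x)` for lazy chains (Levin–Peres–Wilmer Prop. 10.25)

HONEST FRAMING: exact (Metropolis-corrected) sampling algorithms for lattice gauge theory; figures
of merit are autocorrelation/cost numbers at stated couplings and volumes; no continuum-physics claim.

Source: D. A. Levin, Y. Peres (with E. L. Wilmer), *Markov Chains and Mixing Times*, 2nd ed.,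
AMS 2017 [LevinPeres2017], §10.7 PROPOSITION 10.25 (p. 141) with its proof of part (i) via the
Cauchy–Schwarz inequality (eq. (10.36)) and, for part (ii), the eigenvalue route the book points to
("See Exercise 12.5 for a proof using eigenvalues").  Conventions of `TotalVariation.lean`
(`IsRowStochastic`), `MetropolisHastings.lean` (`DetailedBalance`), `SeparationDistance.lean`
(`DetailedBalance.pow_apply`: `π(x)Pᵗ(x,y) = π(y)Pᵗ(y,x)`), `SpectralRepresentation.lean` (Lemma 12.2:
`kernelAt P t x y = Σ_j f_j(x)f_j(y)π(y)λ_jᵗ`), `LazyChainSpectrum.lean` (Exercise 12.3: a lazy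
reversible chain has `λ_j ≥ 0`) and `ErgodicSumVariance.lean` (`|λ_j| ≤ 1`).  Everything is PROVED
(0 named facts, 0 definitions).

* **PROPOSITION 10.25 (i)** `LevinPeres2017_prop_10_25_i` — for a reversible chain (positive
  reversing `π`), `P^{2t+2}(x,x) ≤ P^{2t}(x,x)` for all `t ≥ 0`, `x`.  Proof as printed:
  `π(x)P^{2t+2}(x,x) = Σ_{y,z} π(y)Pᵗ(y,x)P²(y,z)Pᵗ(z,x)` (reversibility) `≤ Σ_{y,z} Pᵗ(y,x)²π(y)P²(y,z)
  = Σ_y Pᵗ(y,x)²π(y) = π(x)P^{2t}(x,x)` — the Cauchy–Schwarz step (10.36) is done as the termwise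
  `2ab ≤ a² + b²` with the `π`-symmetry of `P²` (Exercise 1.8) [cite: LevinPeres2017, §10.7
  Prop. 10.25 (i), eq. (10.36)];
* **PROPOSITION 10.25 (ii)** `LevinPeres2017_prop_10_25_ii` — if `P(x,x) ≥ ½` for all `x` (lazy) and
  `P` is reversible with respect to a positive `π`, then `P^{t+1}(x,x) ≤ Pᵗ(x,x)`.  DECLARED ROUTE:
  the eigenvalue proof of Exercise 12.5 (`Pᵗ(x,x) = π(x)Σ_j f_j(x)²λ_jᵗ` with `0 ≤ λ_j ≤ 1`), not the
  book's augmented chain `K` with `K² = P_L` [cite: LevinPeres2017, §10.7 Prop. 10.25 (ii);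
  Exercise 12.5].

Context (cell pub-lqcd): monotonicity of return probabilities is the hypothesis-free shape
information on the autocorrelation of the indicator `1_x` under a reversible (resp. lazy reversible)
sampler — even-lag (resp. all-lag) autocovariances of a reversible chain's occupation indicators
decrease.
-/

namespace Literature.Probability.MarkovChains

open Finset Matrix

variable {X : Type*} [Fintype X] [DecidableEq X] {P : Matrix X X ℝ} {π : X → ℝ}

/-- **PROPOSITION 10.25 (i): for a reversible chain, `P^{2t+2}(x,x) ≤ P^{2t}(x,x)`** (all `t ≥ 0`,
`x ∈ X`). [cite: LevinPeres2017, §10.7 Prop. 10.25 (i), eq. (10.36)] -/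
theorem LevinPeres2017_prop_10_25_i (hP : IsRowStochastic P) (hDB : DetailedBalance π P)
    (hπ : ∀ x, 0 < π x) (t : ℕ) (x : X) :
    (P ^ (2 * t + 2)) x x ≤ (P ^ (2 * t)) x x := by
  have hP0 : ∀ y z, 0 ≤ P y z := hP.1
  have hQ0 : ∀ y z, 0 ≤ (P ^ t) y z := fun y z => Matrix.pow_apply_nonneg hP0 t y z
  have hS0 : ∀ y z, 0 ≤ (P ^ 2) y z := fun y z => Matrix.pow_apply_nonneg hP0 2 y z
  have hDBt := hDB.pow_apply t
  have hDB2 := hDB.pow_apply 2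
  -- `π(x) P^{2t+2}(x,x) = Σ_y Σ_z π(y) Pᵗ(y,x) P²(y,z) Pᵗ(z,x)`
  have hL : π x * (P ^ (2 * t + 2)) x x =
      ∑ y, ∑ z, π y * (P ^ t) y x * (P ^ 2) y z * (P ^ t) z x := by
    have hpow : P ^ (2 * t + 2) = P ^ t * P ^ 2 * P ^ t := by
      rw [← pow_add, ← pow_add]; congr 1; ring
    rw [hpow]
    have h3 : (P ^ t * P ^ 2 * P ^ t) x x = ∑ z, ∑ y, (P ^ t) x y * (P ^ 2) y z * (P ^ t) z x := by
      rw [mul_apply]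
      refine sum_congr rfl fun z _ => ?_
      rw [mul_apply, sum_mul]
    rw [h3, sum_comm, mul_sum]
    refine sum_congr rfl fun y _ => ?_
    rw [mul_sum]
    refine sum_congr rfl fun z _ => ?_
    calc π x * ((P ^ t) x y * (P ^ 2) y z * (P ^ t) z x)
        = (π x * (P ^ t) x y) * (P ^ 2) y z * (P ^ t) z x := by ring
      _ = π y * (P ^ t) y x * (P ^ 2) y z * (P ^ t) z x := by rw [hDBt x y]
  -- `π(x) P^{2t}(x,x) = Σ_y π(y) Pᵗ(y,x)² = Σ_y Σ_z Pᵗ(y,x)² π(y) P²(y,z)`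
  have hR : π x * (P ^ (2 * t)) x x = ∑ y, ∑ z, (P ^ t) y x ^ 2 * (π y * (P ^ 2) y z) := by
    have hpow : P ^ (2 * t) = P ^ t * P ^ t := by rw [← pow_add]; congr 1; ring
    rw [hpow, mul_apply, mul_sum]
    refine sum_congr rfl fun y _ => ?_
    have h1 : ∑ z, (P ^ t) y x ^ 2 * (π y * (P ^ 2) y z) = (P ^ t) y x ^ 2 * π y := by
      rw [← mul_sum]
      simp_rw [← mul_sum]
      rw [sum_pow_apply_eq_one hP 2 y, mul_one]
    rw [h1]
    have := hDBt x y
    calc π x * ((P ^ t) x y * (P ^ t) y x) = (π x * (P ^ t) x y) * (P ^ t) y x := by ring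
      _ = π y * (P ^ t) y x * (P ^ t) y x := by rw [this]
      _ = (P ^ t) y x ^ 2 * π y := by ring
  -- termwise `2ab·w ≤ (a² + b²)·w`, and the `b²` half is the `a²` half after swapping `y ↔ z`
  have hswap : ∑ y, ∑ z, (P ^ t) z x ^ 2 * (π y * (P ^ 2) y z) =
      ∑ y, ∑ z, (P ^ t) y x ^ 2 * (π y * (P ^ 2) y z) := by
    rw [sum_comm]
    exact sum_congr rfl fun y _ => sum_congr rfl fun z _ => by rw [hDB2 z y]
  have hineq : 2 * ∑ y, ∑ z, π y * (P ^ t) y x * (P ^ 2) y z * (P ^ t) z x ≤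
      ∑ y, ∑ z, (P ^ t) y x ^ 2 * (π y * (P ^ 2) y z) +
        ∑ y, ∑ z, (P ^ t) z x ^ 2 * (π y * (P ^ 2) y z) := by
    rw [mul_sum, ← sum_add_distrib]
    refine sum_le_sum fun y _ => ?_
    rw [mul_sum, ← sum_add_distrib]
    refine sum_le_sum fun z _ => ?_
    have hw : 0 ≤ π y * (P ^ 2) y z := mul_nonneg (hπ y).le (hS0 y z)
    nlinarith [sq_nonneg ((P ^ t) y x - (P ^ t) z x), hw]
  rw [hswap] at hineq
  have hfinal : π x * (P ^ (2 * t + 2)) x x ≤ π x * (P ^ (2 * t)) x x := by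
    rw [hL, hR]; linarith
  exact le_of_mul_le_mul_left hfinal (hπ x)

/-- **PROPOSITION 10.25 (ii): for a LAZY reversible chain (`P(x,x) ≥ ½`), `P^{t+1}(x,x) ≤ Pᵗ(x,x)`**
— by Lemma 12.2, `Pᵗ(x,x) = π(x) Σ_j f_j(x)² λ_jᵗ` with `0 ≤ λ_j ≤ 1` (Exercise 12.3, Lemma 12.1).
[cite: LevinPeres2017, §10.7 Prop. 10.25 (ii); Exercise 12.5] -/
theorem LevinPeres2017_prop_10_25_ii (hP : IsRowStochastic P) (hDB : DetailedBalance π P)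
    (hπ : ∀ x, 0 < π x) (hlazy : ∀ x, 1 / 2 ≤ P x x) (t : ℕ) (x : X) :
    kernelAt P (t + 1) x x ≤ kernelAt P t x x := by
  have hA := symmMatrix_isHermitian hπ hDB
  rw [LevinPeres2017_lemma_12_2 hπ hA (t + 1) x x, LevinPeres2017_lemma_12_2 hπ hA t x x]
  refine sum_le_sum fun j _ => ?_
  have h0 : 0 ≤ specVal hA j := specVal_nonneg_of_lazy hπ hA hP hlazy j
  have h1 : specVal hA j ≤ 1 := by
    by_cases hj : specVal hA j = 1
    · rw [hj]
    · exact (abs_le.1 (abs_specVal_le_one hπ hP hA hj)).2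
  have hw : 0 ≤ specFun hA j x * specFun hA j x * π x := by
    have : 0 ≤ specFun hA j x * specFun hA j x := mul_self_nonneg _
    exact mul_nonneg this (hπ x).le
  exact mul_le_mul_of_nonneg_left (pow_le_pow_of_le_one h0 h1 (Nat.le_succ t)) hw

end Literature.Probability.MarkovChains
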